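import Summits.Ventures.PercRepro2.CaseOneNullDelete
import Summits.Ventures.PercRepro2.CaseOneRootsOnlyQ
import Summits.Ventures.PercRepro2.CaseOneRootsAndOQ
import Summits.Ventures.PercRepro2.CaseOneDWorldLeafI

/-!
# Two-level classes: `a₃` adjacent to the roots and to one vertex `v` which is itself root-only
or roots-and-`o` (blind cell PercRepro2, p1 g19; S5 (S5.a‴) continued)

The D-world forms cross a null edge (`iExprD_restrict_null`, `iiExprD_restrict_null`), so the
hypotheses of the D-world class theorems at the neighbour `v` can be read in `G − e₀`. With the
reductions `zSplitID_of_rootsAndLeaf` (the `(i)` side, CaseOneDWorldLeafI) and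
`zSplitIID_of_rootsAndLeaf` (the `(ii)` side, here, from `zSplitIID_of_rootsAnd` +
`zSplitIID_of_leaf_supp`) and the D-world class theorems at every nonnegative pair
(`iExprD_nonneg_of_rootsOnly`, `iiExprD_nonneg_of_rootsOnly`, `iExprD_nonneg_of_rootsAndO`,
`iiExprD_nonneg_of_rootsAndO`): **`zSplitI/zSplitII/jOneOne_of_rootsAndLeaf_rootsOnly`** and
**`…_rootsAndO`** — `(i)`, `(ii)`, `(J1₁)` for `a₃` adjacent to the roots (any multiplicities) and
to
one vertex `v` whose other edges join the roots (any multiplicities), resp. the roots and `o`; every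
finite graph, every weight vector. Own code; standard axioms.
-/

namespace Summit.Ventures.PercRepro2

namespace CaseOne

/-! ## The D-world forms across a null edge -/

section Null
variable {V : Type*} {E : Type*} [Fintype E] [DecidableEq E] {R : Type*} [CommRing R]
variable {ends : E → Sym2 V} {e₀ : E} {o a₁ a₂ a₃ b : V}

/-- `P(D)` across a null edge. -/
theorem probDw_restrict_null (p : E → R) (hp0 : p e₀ = 0) :
    prob p (Dw ends a₁ a₂ a₃) = prob (restrictW p e₀) (Dw (restrictEnds ends e₀) a₁ a₂ a₃) := by
  refine prob_restrict_null p hp0 _ _ fun ω hω => ?_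
  simp only [Dw, Set.mem_inter_iff, Set.mem_compl_iff, mem_connEvent, conn_restrict_closed hω]

/-- `P(D, b ∈ C₁)` across a null edge. -/
theorem probB1Dw_restrict_null (p : E → R) (hp0 : p e₀ = 0) :
    prob p (connEvent ends a₁ b ∩ Dw ends a₁ a₂ a₃) =
      prob (restrictW p e₀) (connEvent (restrictEnds ends e₀) a₁ b ∩
        Dw (restrictEnds ends e₀) a₁ a₂ a₃) := by
  refine prob_restrict_null p hp0 _ _ fun ω hω => ?_
  simp only [Dw, Set.mem_inter_iff, Set.mem_compl_iff, mem_connEvent, conn_restrict_closed hω]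

/-- `P(D, b ∈ C₂)` across a null edge. -/
theorem probBDw_restrict_null (p : E → R) (hp0 : p e₀ = 0) :
    prob p (connEvent ends a₂ b ∩ Dw ends a₁ a₂ a₃) =
      prob (restrictW p e₀) (connEvent (restrictEnds ends e₀) a₂ b ∩
        Dw (restrictEnds ends e₀) a₁ a₂ a₃) := by
  refine prob_restrict_null p hp0 _ _ fun ω hω => ?_
  simp only [Dw, Set.mem_inter_iff, Set.mem_compl_iff, mem_connEvent, conn_restrict_closed hω]

/-- **`iExprD` across a null edge.** -/
theorem iExprD_restrict_null (p : E → R) (hp0 : p e₀ = 0) (c₀ c₁ : R) :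
    iExprD p ends o a₁ a₂ a₃ b c₀ c₁ =
      iExprD (restrictW p e₀) (restrictEnds ends e₀) o a₁ a₂ a₃ b c₀ c₁ := by
  rw [iExprD_eq, iExprD_eq, probDw_restrict_null p hp0, probQAB1O_restrict_null p hp0,
    probB1Dw_restrict_null p hp0, probQAO_restrict_null p hp0, probQAB1_restrict_null p hp0,
    probQA_restrict_null p hp0]

/-- **`iiExprD` across a null edge.** -/
theorem iiExprD_restrict_null (p : E → R) (hp0 : p e₀ = 0) (c₀ c₁ : R) :
    iiExprD p ends o a₁ a₂ a₃ b c₀ c₁ =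
      iiExprD (restrictW p e₀) (restrictEnds ends e₀) o a₁ a₂ a₃ b c₀ c₁ := by
  rw [iiExprD_eq, iiExprD_eq, probDw_restrict_null p hp0, probQABO_restrict_null p hp0,
    probBDw_restrict_null p hp0, probQAO_restrict_null p hp0, probQAB_restrict_null p hp0,
    probQA_restrict_null p hp0]

end Null

/-! ## The `(ii)` reduction for roots and one further vertex -/

section RootsAndLeafII
variable {V : Type*} {E : Type*} [Fintype E] [DecidableEq E] [Fintype V] [DecidableEq V]
  {R : Type*} [Field R] [LinearOrder R] [IsStrictOrderedRing R]
variable {ends : E → Sym2 V} {a₁ a₂ a₃ : V} {e₀ : E}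

/-- **Roots and one further vertex, D-world `(ii)` form** (the twin of `zSplitID_of_rootsAndLeaf`):
if every edge at `a₃` other than `e₀ = {v, a₃}` joins a root, `ZSplitIID` of `a₃` follows from the
D-world `(ii)` of `v` in `G − a₃` at the PD pair of `a₃`, for every admissible weight vector with
the root edges at `a₃` null. -/
theorem zSplitIID_of_rootsAndLeaf (p : E → R) (hp : IsProbVec p) {v : V}
    (he₀ : ends e₀ = s(v, a₃))
    (hroot : ∀ e, a₃ ∈ ends e → e ≠ e₀ → ends e = s(a₁, a₃) ∨ ends e = s(a₂, a₃)) (hv : v ≠ a₃)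
    {o b : V} (ho : o ≠ a₃) (h1 : a₁ ≠ a₃) (h2 : a₂ ≠ a₃) (hb : b ≠ a₃)
    (base : ∀ p' : E → R, IsProbVec p' → (∀ e, a₃ ∈ ends e → e ≠ e₀ → p' e = 0) →
      0 ≤ iiExprD (Function.update p' e₀ 0) ends o a₁ a₂ v b (Dpdo p' ends o a₁ a₂ a₃)
        (Dpd p' ends a₁ a₂ a₃)) :
    ZSplitIID p ends o a₁ a₂ a₃ b :=
  zSplitIID_of_rootsAnd p hp hroot fun p' hp' hnull =>
    zSplitIID_of_leaf_supp hp' ⟨he₀, hnull, hv⟩ ho h1 h2 hb (base p' hp' hnull)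

end RootsAndLeafII

/-! ## The two-level classes -/

section Classes
variable {V : Type*} {E : Type*} [Fintype E] [DecidableEq E] [Fintype V] [DecidableEq V]
  {R : Type*} [Field R] [LinearOrder R] [IsStrictOrderedRing R]
variable {ends : E → Sym2 V} {o a₁ a₂ a₃ b v : V} {e₀ : E}

/-- **`(i)` for `a₃` adjacent to the roots (any multiplicities) and to `v`, where every other edge
at `v` joins a root (any multiplicities).** -/
theorem zSplitI_of_rootsAndLeaf_rootsOnly (p : E → R) (hp : IsProbVec p)
    (he₀ : ends e₀ = s(v, a₃))
    (hroot : ∀ e, a₃ ∈ ends e → e ≠ e₀ → ends e = s(a₁, a₃) ∨ ends e = s(a₂, a₃))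
    (hvroot : ∀ e, v ∈ ends e → e ≠ e₀ → ends e = s(a₁, v) ∨ ends e = s(a₂, v)) (hv : v ≠ a₃)
    (ho : o ≠ a₃) (h1 : a₁ ≠ a₃) (h2 : a₂ ≠ a₃) (hb : b ≠ a₃) (hv1 : a₁ ≠ v) (hvb : b ≠ v) :
    ZSplitI p ends o a₁ a₂ a₃ b := by
  refine zSplitI_of_dworld p hp ends o a₁ a₂ a₃ b
    (zSplitID_of_rootsAndLeaf p hp he₀ hroot hv ho h1 h2 hb fun p' hp' _ => ?_)
  have hp'' : IsProbVec (Function.update p' e₀ 0) := hp'.update e₀ le_rfl zero_le_one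
  rw [iExprD_restrict_null (e₀ := e₀) (Function.update p' e₀ 0) (by simp)]
  exact iExprD_nonneg_of_rootsOnly (restrictW (Function.update p' e₀ 0) e₀)
    (IsProbVec.restrictW hp'' e₀) (fun e he => hvroot e.1 he e.2) hv1 o hvb _ _
    (prob_nonneg hp' _)

/-- **`(ii)` for the same class.** -/
theorem zSplitII_of_rootsAndLeaf_rootsOnly (p : E → R) (hp : IsProbVec p)
    (he₀ : ends e₀ = s(v, a₃))
    (hroot : ∀ e, a₃ ∈ ends e → e ≠ e₀ → ends e = s(a₁, a₃) ∨ ends e = s(a₂, a₃))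
    (hvroot : ∀ e, v ∈ ends e → e ≠ e₀ → ends e = s(a₁, v) ∨ ends e = s(a₂, v)) (hv : v ≠ a₃)
    (ho : o ≠ a₃) (h1 : a₁ ≠ a₃) (h2 : a₂ ≠ a₃) (hb : b ≠ a₃) (hv1 : a₁ ≠ v) :
    ZSplitII p ends o a₁ a₂ a₃ b := by
  refine zSplitII_of_dworld p hp ends o a₁ a₂ a₃ b
    (zSplitIID_of_rootsAndLeaf p hp he₀ hroot hv ho h1 h2 hb fun p' hp' _ => ?_)
  have hp'' : IsProbVec (Function.update p' e₀ 0) := hp'.update e₀ le_rfl zero_le_one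
  rw [iiExprD_restrict_null (e₀ := e₀) (Function.update p' e₀ 0) (by simp)]
  exact iiExprD_nonneg_of_rootsOnly (restrictW (Function.update p' e₀ 0) e₀)
    (IsProbVec.restrictW hp'' e₀) (fun e he => hvroot e.1 he e.2) hv1 o b _ _
    (prob_nonneg hp' _)

/-- **`(J1₁)` for the same class.** -/
theorem jOneOne_of_rootsAndLeaf_rootsOnly (p : E → R) (hp : IsProbVec p)
    (he₀ : ends e₀ = s(v, a₃))
    (hroot : ∀ e, a₃ ∈ ends e → e ≠ e₀ → ends e = s(a₁, a₃) ∨ ends e = s(a₂, a₃))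
    (hvroot : ∀ e, v ∈ ends e → e ≠ e₀ → ends e = s(a₁, v) ∨ ends e = s(a₂, v)) (hv : v ≠ a₃)
    (ho : o ≠ a₃) (h1 : a₁ ≠ a₃) (h2 : a₂ ≠ a₃) (hb : b ≠ a₃) (hv1 : a₁ ≠ v) (hvb : b ≠ v) :
    JOneOne p ends o a₁ a₂ a₃ b :=
  jOneOne_of_i_of_ii p ends o a₁ a₂ a₃ b
    (zSplitI_of_rootsAndLeaf_rootsOnly p hp he₀ hroot hvroot hv ho h1 h2 hb hv1 hvb)
    (zSplitII_of_rootsAndLeaf_rootsOnly p hp he₀ hroot hvroot hv ho h1 h2 hb hv1)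

variable {eo : E}

/-- **`(i)` for `a₃` adjacent to the roots (any multiplicities) and to `v`, where `v` has the edge
`eo = {o, v}` and every other edge at `v` joins a root (any multiplicities).** -/
theorem zSplitI_of_rootsAndLeaf_rootsAndO (p : E → R) (hp : IsProbVec p)
    (he₀ : ends e₀ = s(v, a₃))
    (hroot : ∀ e, a₃ ∈ ends e → e ≠ e₀ → ends e = s(a₁, a₃) ∨ ends e = s(a₂, a₃))
    (heo : ends eo = s(o, v))
    (hvroot : ∀ e, v ∈ ends e → e ≠ e₀ → e ≠ eo → ends e = s(a₁, v) ∨ ends e = s(a₂, v))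
    (hv : v ≠ a₃) (ho : o ≠ a₃) (h1 : a₁ ≠ a₃) (h2 : a₂ ≠ a₃) (hb : b ≠ a₃) (hov : o ≠ v)
    (hv1 : a₁ ≠ v) (hvb : b ≠ v) : ZSplitI p ends o a₁ a₂ a₃ b := by
  have heo₀ : eo ≠ e₀ := by
    rintro rfl
    rw [he₀] at heo
    rcases Sym2.eq_iff.1 heo with ⟨h', _⟩ | ⟨_, h'⟩
    · exact hov h'.symm
    · exact ho h'.symm
  refine zSplitI_of_dworld p hp ends o a₁ a₂ a₃ b
    (zSplitID_of_rootsAndLeaf p hp he₀ hroot hv ho h1 h2 hb fun p' hp' _ => ?_)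
  have hp'' : IsProbVec (Function.update p' e₀ 0) := hp'.update e₀ le_rfl zero_le_one
  rw [iExprD_restrict_null (e₀ := e₀) (Function.update p' e₀ 0) (by simp)]
  exact iExprD_nonneg_of_rootsAndO (restrictW (Function.update p' e₀ 0) e₀)
    (IsProbVec.restrictW hp'' e₀) (e₀ := ⟨eo, heo₀⟩) heo
    (fun e he hne => hvroot e.1 he e.2 fun h' => hne (Subtype.ext h')) hov hv1 hvb _ _
    (prob_nonneg hp' _) (prob_nonneg hp' _)

/-- **`(ii)` for the same class.** -/
theorem zSplitII_of_rootsAndLeaf_rootsAndO (p : E → R) (hp : IsProbVec p)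
    (he₀ : ends e₀ = s(v, a₃))
    (hroot : ∀ e, a₃ ∈ ends e → e ≠ e₀ → ends e = s(a₁, a₃) ∨ ends e = s(a₂, a₃))
    (heo : ends eo = s(o, v))
    (hvroot : ∀ e, v ∈ ends e → e ≠ e₀ → e ≠ eo → ends e = s(a₁, v) ∨ ends e = s(a₂, v))
    (hv : v ≠ a₃) (ho : o ≠ a₃) (h1 : a₁ ≠ a₃) (h2 : a₂ ≠ a₃) (hb : b ≠ a₃) (hov : o ≠ v)
    (hv1 : a₁ ≠ v) : ZSplitII p ends o a₁ a₂ a₃ b := by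
  have heo₀ : eo ≠ e₀ := by
    rintro rfl
    rw [he₀] at heo
    rcases Sym2.eq_iff.1 heo with ⟨h', _⟩ | ⟨_, h'⟩
    · exact hov h'.symm
    · exact ho h'.symm
  refine zSplitII_of_dworld p hp ends o a₁ a₂ a₃ b
    (zSplitIID_of_rootsAndLeaf p hp he₀ hroot hv ho h1 h2 hb fun p' hp' _ => ?_)
  have hp'' : IsProbVec (Function.update p' e₀ 0) := hp'.update e₀ le_rfl zero_le_one
  rw [iiExprD_restrict_null (e₀ := e₀) (Function.update p' e₀ 0) (by simp)]
  exact iiExprD_nonneg_of_rootsAndO (restrictW (Function.update p' e₀ 0) e₀)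
    (IsProbVec.restrictW hp'' e₀) (e₀ := ⟨eo, heo₀⟩) heo
    (fun e he hne => hvroot e.1 he e.2 fun h' => hne (Subtype.ext h')) hov hv1 b _ _
    (prob_nonneg hp' _) (prob_nonneg hp' _)

/-- **`(J1₁)` for the same class.** -/
theorem jOneOne_of_rootsAndLeaf_rootsAndO (p : E → R) (hp : IsProbVec p)
    (he₀ : ends e₀ = s(v, a₃))
    (hroot : ∀ e, a₃ ∈ ends e → e ≠ e₀ → ends e = s(a₁, a₃) ∨ ends e = s(a₂, a₃))
    (heo : ends eo = s(o, v))
    (hvroot : ∀ e, v ∈ ends e → e ≠ e₀ → e ≠ eo → ends e = s(a₁, v) ∨ ends e = s(a₂, v))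
    (hv : v ≠ a₃) (ho : o ≠ a₃) (h1 : a₁ ≠ a₃) (h2 : a₂ ≠ a₃) (hb : b ≠ a₃) (hov : o ≠ v)
    (hv1 : a₁ ≠ v) (hvb : b ≠ v) : JOneOne p ends o a₁ a₂ a₃ b :=
  jOneOne_of_i_of_ii p ends o a₁ a₂ a₃ b
    (zSplitI_of_rootsAndLeaf_rootsAndO p hp he₀ hroot heo hvroot hv ho h1 h2 hb hov hv1 hvb)
    (zSplitII_of_rootsAndLeaf_rootsAndO p hp he₀ hroot heo hvroot hv ho h1 h2 hb hov hv1)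

end Classes

end CaseOne

end Summit.Ventures.PercRepro2
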